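import Literature.AlgebraicGeometry.Motives.CyclesGraphClosure
import Literature.AlgebraicGeometry.Motives.ProjectiveLineInvolution
import Literature.AlgebraicGeometry.Motives.ProjectiveSpaceFunctionField
import Literature.AlgebraicGeometry.Morphisms.IsoOverOpen
import Literature.AlgebraicGeometry.Resolution.ResolutionOfSingularities
import Mathlib.AlgebraicGeometry.Morphisms.Proper

/-!
# `WeightedInvariant.WeightedThesis`, line `datum-glued-split`, stub B:
# the closure of the graph of a transcendental rational function

Support file for the finite-field branch of crux `WeightedThesis`
(stmt-ResolutionOfSingularities-0569), all PROVED. For `X` integral and locally Noetherian over a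
field `k` and `w ∈ K(X)` transcendental over `k`:

* `GraphClosure.exists_graphClosure_isBirational` — the tree's
  `Literature.AlgebraicGeometry.Motives.exists_graphClosure` (the scheme-theoretic image `X'` of
  the graph `U → X ×_k P` of `w` on an affine open `U` where `w` is regular, for an abstract proper
  integral `k`-scheme `P` with a coordinate `t` and coordinate morphisms `ρ_a : U → P`) with two
  extra outputs on the SAME `X'`: `π : X' → X` is BIRATIONAL (an isomorphism over `U`, Stacks 01RH
  in the tree's form `Literature.AlgebraicGeometry.Morphisms.GraphClosure.isIso_morphismRestrict`)
  and `(π, ψ) : X' → X ×_k P` is a closed immersion (it is the inclusion of the scheme-theoretic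
  image);
* `GraphClosure.graphClosure_projectiveLine` — the instance `P = ℙ¹_k`, `t = x₁/x₀`,
  `ρ_a = (1 : a)` (`Motives/ProjectiveLineInvolution`);
* the registered shape `stub_graphClosure`.

[Fulton 1998, Prop. 1.4 (a), proof; Hartshorne 1977, II Ex. 4.2; Stacks 01RH]
-/

noncomputable section

set_option linter.dupNamespace false -- mandated namespace of this single-conjunct summit

open CategoryTheory CategoryTheory.Limits AlgebraicGeometry TopologicalSpace Topology
open Literature.AlgebraicGeometry.Resolution Literature.AlgebraicGeometry.Motives

namespace Summit.ResolutionOfSingularities.ResolutionOfSingularities.Theorems.WeightedThesis.HypersurfaceModel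

namespace GraphClosure

universe u

/-- **The closure of the graph of a rational function, with birationality.** Let `X` be an
integral locally Noetherian scheme over a field `k`, `r ∈ K(X)` transcendental over `k`, and `P` a
proper integral `k`-scheme with a rational function `t` and `k`-morphisms `ρ_a : U → P`
("`(1 : a)`") for functions `a` on affine integral `k`-schemes `U`, dominant for transcendental
`a`, with `ρ_a^♯ t = a`. Then the scheme-theoretic image `X'` of the graph `U → X ×_k P` of
`ρ_{r|U}` on an affine open `U` where `r` is regular is integral, `π : X' → X` is proper, dominant
and birational (an isomorphism over `U`), `(π, ψ) : X' → X ×_k P` is a closed immersion,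
`π^♯ : K(X) ≅ K(X')`, and `ψ : X' → P` is a dominant `k`-morphism with `ψ^♯ t = π^♯ r`
(the proof of `Literature.AlgebraicGeometry.Motives.exists_graphClosure`, plus Stacks 01RH).
[cite: Fulton1998, Prop. 1.4 (a), proof] -/
theorem exists_graphClosure_isBirational {k : Type u} [Field k] {X : Scheme.{u}} [IsIntegral X]
    [IsLocallyNoetherian X] (fX : X ⟶ Spec (.of k)) (r : X.functionField)
    (htr : letI := ((X.presheaf.germ ⊤ (genericPoint X) trivial).hom.comp
        (fX.appTop.hom.comp (Scheme.ΓSpecIso (.of k)).inv.hom)).toAlgebra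
      Transcendental k r)
    {P : Scheme.{u}} [IsIntegral P] (toS : P ⟶ Spec (.of k)) [IsProper toS]
    (t : P.functionField)
    (huniv : ∀ (U : Scheme.{u}) [IsIntegral U] [IsAffine U] (u : U ⟶ Spec (.of k))
        (a : Γ(U, ⊤)), ∃ ρ : U ⟶ P, ρ ≫ toS = u ∧
          ((letI := (Segre.pull u).toAlgebra; Transcendental k a) → IsDominant ρ) ∧
          ∀ [IsDominant ρ],
            RatFn.functionFieldMap ρ t = U.presheaf.germ ⊤ (genericPoint U) trivial a) :
    ∃ (X' : Scheme.{u}) (_ : IsIntegral X') (π : X' ⟶ X) (_ : IsProper π) (_ : IsDominant π)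
      (ψ : X' ⟶ P) (_ : IsDominant ψ) (hc : π ≫ fX = ψ ≫ toS),
      IsBirational π ∧ IsClosedImmersion (pullback.lift π ψ hc) ∧
      Function.Bijective (RatFn.functionFieldMap π) ∧
      RatFn.functionFieldMap ψ t = RatFn.functionFieldMap π r := by
  -- adapted from Literature/AlgebraicGeometry/Motives/CyclesGraphClosure.lean (`exists_graphClosure`)
  have hr : r ≠ 0 := by
    letI := ((X.presheaf.germ ⊤ (genericPoint X) trivial).hom.comp
        (fX.appTop.hom.comp (Scheme.ΓSpecIso (.of k)).inv.hom)).toAlgebra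
    rintro rfl
    exact htr (isAlgebraic_zero (R := k))
  -- an affine open `U` on which `r` is a regular function `f'`
  obtain ⟨U, hUaff, f', hne, hf'r, -⟩ := exists_isUnit_germ_eq X r hr
  have hU : IsAffineOpen U := hUaff
  haveI : IsAffine U := hU
  haveI : Nonempty U := hne
  let u : (U : Scheme.{u}) ⟶ Spec (.of k) := U.ι ≫ fX
  let a : Γ(U, ⊤) := U.topIso.inv f'
  obtain ⟨ρ, hρS, hρdom, hρt⟩ := huniv U u a
  -- `a ↦ r` under the injective `k`-algebra map `Γ(U, 𝒪_U) → R(X)`, so `a` is transcendental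
  have ha : (letI := (Segre.pull u).toAlgebra; Transcendental k a) := by
    letI algU := (Segre.pull u).toAlgebra
    letI algX := ((X.presheaf.germ ⊤ (genericPoint X) trivial).hom.comp
        (fX.appTop.hom.comp (Scheme.ΓSpecIso (.of k)).inv.hom)).toAlgebra
    let θ : Γ(U, ⊤) →ₐ[k] X.functionField :=
      { toRingHom := (X.germToFunctionField U).hom.comp U.topIso.hom.hom
        commutes' := fun c ↦ by
          change X.germToFunctionField U (U.topIso.hom (U.ι.appTop (fX.appTop _))) =
            X.presheaf.germ ⊤ (genericPoint X) trivial (fX.appTop _)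
          have h1 : U.topIso.hom (U.ι.appTop (fX.appTop ((Scheme.ΓSpecIso (.of k)).inv c))) =
              X.presheaf.map (homOfLE le_top).op
                (fX.appTop ((Scheme.ΓSpecIso (.of k)).inv c)) := by
            simp only [Scheme.Opens.topIso_hom, Scheme.Opens.ι_appTop]
            rw [← CommRingCat.comp_apply]
            erw [← X.presheaf.map_comp]
            rfl
          erw [h1]
          rw [Scheme.germToFunctionField, TopCat.Presheaf.germ_res_apply] }
    have hθ : Function.Injective θ :=
      (X.germToFunctionField_injective U).comp U.topIso.commRingCatIsoToRingEquiv.injective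
    have hθa : θ a = r := by
      change X.germToFunctionField U (U.topIso.hom (U.topIso.inv f')) = r
      rw [CategoryTheory.Iso.inv_hom_id_apply, hf'r]
    intro halg
    exact htr (hθa ▸ halg.algHom θ)
  haveI : IsDominant ρ := hρdom ha
  -- the graph of `ρ` in `X ×_k P` and its scheme-theoretic image
  let γ : (U : Scheme.{u}) ⟶ pullback fX toS := pullback.lift U.ι ρ (by rw [hρS])
  haveI : QuasiCompact γ := inferInstance
  haveI hX' : IsIntegral γ.image := isIntegral_image_of_isIntegral γ
  have hγ₁ : γ ≫ pullback.fst fX toS = U.ι := pullback.lift_fst _ _ _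
  have hγ₂ : γ ≫ pullback.snd fX toS = ρ := pullback.lift_snd _ _ _
  -- `π : X' → X` is proper and dominant, `ψ : X' → P` is dominant
  haveI : IsDominant U.ι := ProjLine.isDominant_of_isOpenImmersion U.ι
  haveI : IsDominant (γ.toImage ≫ γ.imageι ≫ pullback.fst fX toS) := by
    rw [Scheme.Hom.toImage_imageι_assoc, hγ₁]; infer_instance
  haveI hπd : IsDominant (γ.imageι ≫ pullback.fst fX toS) := IsDominant.of_comp γ.toImage _
  haveI : IsDominant (γ.toImage ≫ γ.imageι ≫ pullback.snd fX toS) := by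
    rw [Scheme.Hom.toImage_imageι_assoc, hγ₂]; infer_instance
  haveI hψd : IsDominant (γ.imageι ≫ pullback.snd fX toS) := IsDominant.of_comp γ.toImage _
  haveI hπp : IsProper (γ.imageι ≫ pullback.fst fX toS) := inferInstance
  -- functoriality of `(-)^♯` along `toImage ≫ π = U.ι` and `toImage ≫ ψ = ρ`
  have hcongr : ∀ {Z : Scheme.{u}} [IsIntegral Z] {f g : (U : Scheme.{u}) ⟶ Z} [IsDominant f]
      [IsDominant g], f = g → RatFn.functionFieldMap f = RatFn.functionFieldMap g := by
    intro Z _ f g _ _ h; subst h; rfl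
  have hπsharp : (RatFn.functionFieldMap γ.toImage).comp
      (RatFn.functionFieldMap (γ.imageι ≫ pullback.fst fX toS)) = RatFn.functionFieldMap U.ι := by
    rw [← RatFn.functionFieldMap_comp, hcongr (by rw [Scheme.Hom.toImage_imageι_assoc, hγ₁])]
  have hψsharp : (RatFn.functionFieldMap γ.toImage).comp
      (RatFn.functionFieldMap (γ.imageι ≫ pullback.snd fX toS)) = RatFn.functionFieldMap ρ := by
    rw [← RatFn.functionFieldMap_comp, hcongr (by rw [Scheme.Hom.toImage_imageι_assoc, hγ₂])]
  have hιbij := functionFieldMap_bijective_of_isOpenImmersion U.ι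
  have hc : (γ.imageι ≫ pullback.fst fX toS) ≫ fX = (γ.imageι ≫ pullback.snd fX toS) ≫ toS := by
    simp only [Category.assoc, pullback.condition]
  -- EXTRA OUTPUT 1: `π` is an isomorphism over `U` (Stacks 01RH), hence birational
  have hbir : IsBirational (γ.imageι ≫ pullback.fst fX toS) := by
    haveI hiso : IsIso ((γ.imageι ≫ pullback.fst fX toS) ∣_ U.ι.opensRange) :=
      Literature.AlgebraicGeometry.Morphisms.GraphClosure.isIso_morphismRestrict U.ι
        (pullback.fst fX toS) γ hγ₁
    refine ⟨U.ι.opensRange, ?_, ?_, hiso⟩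
    · obtain ⟨x⟩ := hne
      exact U.ι.opensRange.2.dense ⟨U.ι.base x, ⟨x, rfl⟩⟩
    · obtain ⟨x⟩ := hne
      obtain ⟨y, hy⟩ := (γ.imageι ≫ pullback.fst fX toS).denseRange.exists_mem_open
        U.ι.opensRange.2 ⟨U.ι.base x, ⟨x, rfl⟩⟩
      exact ((γ.imageι ≫ pullback.fst fX toS) ⁻¹ᵁ U.ι.opensRange).2.dense ⟨y, hy⟩
  -- EXTRA OUTPUT 2: `(π, ψ) = imageι` is a closed immersion
  have hlift : pullback.lift (γ.imageι ≫ pullback.fst fX toS) (γ.imageι ≫ pullback.snd fX toS) hc =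
      γ.imageι := by
    apply pullback.hom_ext
    · rw [pullback.lift_fst]
    · rw [pullback.lift_snd]
  have hci : IsClosedImmersion
      (pullback.lift (γ.imageι ≫ pullback.fst fX toS) (γ.imageι ≫ pullback.snd fX toS) hc) := by
    rw [hlift]; infer_instance
  refine ⟨γ.image, hX', γ.imageι ≫ pullback.fst fX toS, hπp, hπd, γ.imageι ≫ pullback.snd fX toS,
    hψd, hc, hbir, hci, ?_, ?_⟩
  · refine ⟨RingHom.injective _, fun y ↦ ?_⟩
    obtain ⟨x, hx⟩ := hιbij.2 (RatFn.functionFieldMap γ.toImage y)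
    refine ⟨x, (RatFn.functionFieldMap γ.toImage).injective ?_⟩
    rw [← hx, ← RingHom.comp_apply, hπsharp]
  · apply (RatFn.functionFieldMap γ.toImage).injective
    rw [← RingHom.comp_apply, hψsharp, ← RingHom.comp_apply, hπsharp, hρt, ← hf'r]
    -- both sides are the germ of `f'` at the generic point of `U`
    have hmem : U.ι.base (genericPoint U) ∈ U := (genericPoint (U : Scheme.{u})).2
    haveI : Nonempty (U.ι ⁻¹ᵁ U) := ⟨⟨_, hmem⟩⟩
    rw [functionFieldMap_germToFunctionField U.ι U f' (genericPoint U) hmem]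
    have key : U.ι.app U f' =
        (U : Scheme.{u}).presheaf.map (eqToHom U.ι_preimage_self).op (U.topIso.inv f') := by
      simp only [Scheme.Opens.topIso_inv, Scheme.Opens.ι_app]
      rw [← CommRingCat.comp_apply]
      erw [← X.presheaf.map_comp]
      rfl
    rw [key, Scheme.germToFunctionField, TopCat.Presheaf.germ_res_apply]

/-- **The closure of the graph of a transcendental rational function in `X ×_k ℙ¹`.** The instance
`P = ℙ¹_k = ProjSpace.P 1 k`, `t = x₁/x₀ = ProjLine.t k`, `ρ_a = (1 : a) = ProjLine.ρ` of
`exists_graphClosure_isBirational` (`Motives/ProjectiveLineInvolution`: `ρ_toSpec`,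
`isDominant_ρ`, `functionFieldMap_ρ_t`). [cite: Fulton1998, Prop. 1.4 (a), proof] -/
theorem graphClosure_projectiveLine {k : Type u} [Field k] {X : Scheme.{u}} [IsIntegral X]
    [IsLocallyNoetherian X] (fX : X ⟶ Spec (.of k)) (w : X.functionField)
    (htr : letI := ((X.presheaf.germ ⊤ (genericPoint X) trivial).hom.comp
        (fX.appTop.hom.comp (Scheme.ΓSpecIso (.of k)).inv.hom)).toAlgebra
      Transcendental k w) :
    ∃ (X' : Scheme.{u}) (_ : IsIntegral X') (π : X' ⟶ X) (_ : IsProper π) (_ : IsDominant π)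
      (ψ : X' ⟶ ProjSpace.P 1 k) (_ : IsDominant ψ)
      (hc : π ≫ fX = ψ ≫ Segre.toSpec (Fin (1 + 1)) k),
      IsBirational π ∧ IsClosedImmersion (pullback.lift π ψ hc) ∧
      Function.Bijective (RatFn.functionFieldMap π) ∧
      RatFn.functionFieldMap ψ (ProjLine.t k) = RatFn.functionFieldMap π w := by
  haveI : IsProper (Segre.toSpec (Fin (1 + 1)) k) :=
    ProjBaseChangeRing.isProper_projToSpec (Fin (1 + 1)) k
  exact exists_graphClosure_isBirational fX w htr (Segre.toSpec (Fin (1 + 1)) k) (ProjLine.t k)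
    (fun U _ _ u a => ⟨ProjLine.ρ u a, ProjLine.ρ_toSpec u a, ProjLine.isDominant_ρ u a,
      ProjLine.functionFieldMap_ρ_t u a⟩)

end GraphClosure

/-- STUB B (registered shape): **the closure of the graph of a transcendental rational function.**
For `X` integral and locally Noetherian over a field `k` and `w ∈ K(X)` transcendental over `k`,
the scheme-theoretic image `X'` of the graph `U → X ×_k ℙ¹` of `w` on an affine open `U` where `w`
is regular is integral; `π : X' → X` is proper, dominant and BIRATIONAL (an isomorphism over `U`:
Stacks 01RH, tree `Morphisms/IsoOverOpen.GraphClosure.isIso_morphismRestrict`),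
`(π, ψ) : X' → X ×_k ℙ¹` is a closed immersion, `π^♯ : K(X) ≅ K(X')`, and the second projection
`ψ : X' → ℙ¹` is a dominant `k`-morphism with `ψ^♯ t = π^♯ w` for the coordinate `t = x₁/x₀`
(`GraphClosure.graphClosure_projectiveLine`).
[cite: Fulton1998, Prop. 1.4 (a), proof] -/
theorem stub_graphClosure :
    ∀ (k : Type) [Field k] (X : AlgebraicGeometry.Scheme.{0}) [AlgebraicGeometry.IsIntegral X]
      [AlgebraicGeometry.IsLocallyNoetherian X] (fX : X ⟶ AlgebraicGeometry.Spec (.of k))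
      (w : X.functionField),
      (letI := ((X.presheaf.germ ⊤ (genericPoint X) trivial).hom.comp
          (fX.appTop.hom.comp (AlgebraicGeometry.Scheme.ΓSpecIso (.of k)).inv.hom)).toAlgebra;
        Transcendental k w) →
      ∃ (X' : AlgebraicGeometry.Scheme.{0}) (_ : AlgebraicGeometry.IsIntegral X') (π : X' ⟶ X)
        (_ : AlgebraicGeometry.IsProper π) (_ : AlgebraicGeometry.IsDominant π)
        (ψ : X' ⟶ Literature.AlgebraicGeometry.Motives.ProjSpace.P 1 k)
        (_ : AlgebraicGeometry.IsDominant ψ)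
        (hc : π ≫ fX = ψ ≫ Literature.AlgebraicGeometry.Motives.Segre.toSpec (Fin (1 + 1)) k),
        Literature.AlgebraicGeometry.Resolution.IsBirational π ∧
        AlgebraicGeometry.IsClosedImmersion (CategoryTheory.Limits.pullback.lift π ψ hc) ∧
        Function.Bijective (Literature.AlgebraicGeometry.Motives.RatFn.functionFieldMap π) ∧
        Literature.AlgebraicGeometry.Motives.RatFn.functionFieldMap ψ
            (Literature.AlgebraicGeometry.Motives.ProjLine.t k) =
          Literature.AlgebraicGeometry.Motives.RatFn.functionFieldMap π w :=
  fun _ _ _ _ _ fX w htr => GraphClosure.graphClosure_projectiveLine fX w htr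

end Summit.ResolutionOfSingularities.ResolutionOfSingularities.Theorems.WeightedThesis.HypersurfaceModel

end
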